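import Mathlib
import Summits.RiemannHypothesis.Statement
import Summits.RiemannHypothesis.RiemannHypothesis.Theorems.DeBrangesChainDefs
import Summits.RiemannHypothesis.RiemannHypothesis.Theorems.DeBrangesChainSeparation
import Literature.NumberTheory.LFunctions.SuzukiWeilHilbertSpaceDefs
import Literature.NumberTheory.LFunctions.WeilZeroSum
import HarnessLib
import HarnessLib.Audit

/-!
# RiemannHypothesis / COLUMN 6 (DBR) — the RH-FREE door `ChainDoorV0` PROVED (C2 isolation, cell rh-crit/dbl)

LINE 1 — LABEL: RH-FREE theorem about an RH-EQUIVALENT criterion. `chainDoorV0_proof :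
Theorems.DeBrangesChain.ChainDoorV0`, i.e. `IsolatedV0 → RiemannHypothesis`, where `IsolatedV0` is
the DECLARED RESIDUAL (RH-EQUIVALENT·PRINTED: M. Suzuki, Canad. J. Math. (2025) = arXiv:2301.00421,
Thm. 1.3 conditions (1) ∧ (2) on `V(0) = L²(0,∞) ∩ 𝖪L²(0,∞)`; `Theorems/DeBrangesChainDefs.lean`).
This is the printed sufficiency half of Thm. 1.3 (§3.4, p. 7 L129–149), the CHEAP direction; the deep
half (RH ⟹ `IsolatedV0`, Thm. 1.2) is an RH-CONSEQUENCE and is not claimed anywhere in the tree.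
bears_on: B-C/B-P (LADDER-RH §1 COLUMN 6 DBR): the rung leaf `ChainDoorV0` is kernel-proved; the
residual `IsolatedV0` stays RH-EQUIVALENT and unclaimed. WHAT THIS IS NOT: not progress on RH —
formalising this door fixes WHICH identity on Suzuki's RH-free space would prove RH; proving it is
transcription-grade work; nothing here bears on the truth of RH.

PROOF (as printed, with honest constants). If RH failed, take an off-line non-trivial zero `ρ₀`
(`exists_offLine_of_not_riemannHypothesis`, D3) and its reflection `1 − ρ̄₀ ≠ ρ₀`
(`γ(1 − ρ̄₀) = γ̄₀`). Condition (2) at `ρ₀` and at `1 − ρ̄₀`, with the `ε` of D2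
(`weilSum_re_neg_of_separation`, `Theorems/DeBrangesChainSeparation.lean`), gives `ψ₁, ψ₂ ∈ V(0)`
with `ψ̂₁(γ₀) = 1`, `ψ̂₂(γ̄₀) = 1` and separated values elsewhere; `ψ := ψ₁ − ψ₂ ∈ V(0)`
(`sub_mem_suzukiV`) has the values `c₁ − c₂` at every zero (`hasHatValue_sub` — additivity is the
ONLY property of the objects used; no isometry, no `𝖪² = id`, no boundary-value theorem), so
condition (1) makes the Weil sum of `c₁ − c₂` equal to `2‖ψ‖² ≥ 0`, while D2 makes its real part
negative. Filed `--supports` the column's open DBR residual item as a filing attachment until route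
«DeBrangesChain» (rh-crit-routes-2) registers `ChainDoorV0` as its leaf.
-/

noncomputable section

-- D-0017: `Summit.<S>.<S>.…` is the designed namespace of a single-problem summit.
set_option linter.dupNamespace false

namespace Summit.RiemannHypothesis.RiemannHypothesis.Theorems.DeBrangesChain

open Literature.NumberTheory.LFunctions MeasureTheory Complex Filter Set
open scoped ComplexConjugate Topology

/-! ## D3 — dictionary: an off-line non-trivial zero under `¬RH`; the reflection `ρ ↦ 1 − ρ̄` -/

/-- If RH fails there is a non-trivial zero of `ζ` off the critical line (Mathlib's
`RiemannHypothesis` unfolded; the set of non-trivial zeros is `ZetaZeros.riemannZetaNontrivialZeros`). -/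
theorem exists_offLine_of_not_riemannHypothesis (h : ¬ _root_.RiemannHypothesis) :
    ∃ ρ ∈ ZetaZeros.riemannZetaNontrivialZeros, ρ.re ≠ 1 / 2 := by
  by_contra hcon
  push Not at hcon
  apply h
  intro s hs htriv _
  exact hcon s ⟨hs, fun ⟨k, hk⟩ ↦ htriv ⟨k, hk.symm⟩⟩

/-! ## The door -/

/-- **THE DOOR `ChainDoorV0` (RH-FREE; [Su25c] Thm. 1.3 ⟸, §3.4): `IsolatedV0 → RiemannHypothesis`.**
If RH failed, take an off-line zero `ρ₀`; condition (2) at `ρ₀` and at `1 − ρ̄₀` gives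
`ψ₁, ψ₂ ∈ V(0)` with `ψ̂₁(γ₀) = 1`, `ψ̂₂(γ̄₀) = 1` and separated values elsewhere; `ψ := ψ₁ − ψ₂ ∈ V(0)`
(additivity of `𝖪`) has values `c₁ − c₂` at every zero (additivity of the evaluation), so condition
(1) makes the Weil sum of `c₁ − c₂` equal to `2‖ψ‖² ≥ 0`, while D2 makes its real part negative. -/
theorem chainDoorV0_proof : ChainDoorV0 := by
  classical
  rintro ⟨hC1, hC2⟩
  by_contra hRH
  obtain ⟨ρ₀, hρ₀, hoff⟩ := exists_offLine_of_not_riemannHypothesis hRH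
  obtain ⟨δ, hδ, hsep⟩ := hC2
  obtain ⟨ε, hε, hneg⟩ := weilSum_re_neg_of_separation hρ₀ hoff hδ
  have hρ₁ : 1 - conj ρ₀ ∈ ZetaZeros.riemannZetaNontrivialZeros :=
    ZetaZeros.riemannZetaNontrivialZeros.one_sub_conj_mem hρ₀
  have hne : 1 - conj ρ₀ ≠ ρ₀ := one_sub_conj_ne_self hoff
  obtain ⟨ψ₁, hψ₁V, hψ₁one, hψ₁bd⟩ := hsep ρ₀ hρ₀ ε hε
  obtain ⟨ψ₂, hψ₂V, hψ₂one, hψ₂bd⟩ := hsep (1 - conj ρ₀) hρ₁ ε hε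
  choose! v₁ hv₁ hv₁b using hψ₁bd
  choose! v₂ hv₂ hv₂b using hψ₂bd
  -- total value assignments on `ℂ` (only their values on `Γ` matter)
  set c₁ : ℂ → ℂ := Function.update (fun z ↦ v₁ (1 / 2 - I * z)) (suzukiZeroParam ρ₀) 1 with hc₁def
  set c₂ : ℂ → ℂ := Function.update (fun z ↦ v₂ (1 / 2 - I * z)) (suzukiZeroParam (1 - conj ρ₀)) 1
    with hc₂def
  have hc₁₀ : c₁ (suzukiZeroParam ρ₀) = 1 := by
    simp only [hc₁def, Function.update_self]
  have hc₂₀ : c₂ (suzukiZeroParam (1 - conj ρ₀)) = 1 := by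
    simp only [hc₂def, Function.update_self]
  have hc₁ : ∀ ρ : ℂ, ρ ≠ ρ₀ → c₁ (suzukiZeroParam ρ) = v₁ ρ := by
    intro ρ h
    simp only [hc₁def, Function.update_of_ne (suzukiZeroParam_injective.ne h),
      one_half_sub_I_mul_suzukiZeroParam]
  have hc₂ : ∀ ρ : ℂ, ρ ≠ 1 - conj ρ₀ → c₂ (suzukiZeroParam ρ) = v₂ ρ := by
    intro ρ h
    simp only [hc₂def, Function.update_of_ne (suzukiZeroParam_injective.ne h),
      one_half_sub_I_mul_suzukiZeroParam]
  -- `ψ := ψ₁ − ψ₂ ∈ V(0)` with values `c₁ − c₂`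
  have hψV : ψ₁ - ψ₂ ∈ suzukiV 0 := sub_mem_suzukiV hψ₁V hψ₂V
  have hvals : ∀ ρ ∈ ZetaZeros.riemannZetaNontrivialZeros,
      HasHatValue (ψ₁ - ψ₂) (suzukiZeroParam ρ)
        ((fun z ↦ c₁ z - c₂ z) (suzukiZeroParam ρ)) := by
    intro ρ hρ
    refine hasHatValue_sub ?_ ?_
    · by_cases h : ρ = ρ₀
      · rw [h, hc₁₀]; exact hψ₁one
      · rw [hc₁ ρ h]; exact hv₁ ρ hρ h
    · by_cases h : ρ = 1 - conj ρ₀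
      · rw [h, hc₂₀]; exact hψ₂one
      · rw [hc₂ ρ h]; exact hv₂ ρ hρ h
  have hsum := hC1 (ψ₁ - ψ₂) hψV (fun z ↦ c₁ z - c₂ z) hvals
  have hb1 : ∀ ρ ∈ ZetaZeros.riemannZetaNontrivialZeros, ρ ≠ ρ₀ →
      ‖c₁ (suzukiZeroParam ρ)‖ ≤ ε / ‖suzukiZeroParam ρ₀ - suzukiZeroParam ρ‖ ^ (1 + δ) := by
    intro ρ hρ h; rw [hc₁ ρ h]; exact hv₁b ρ hρ h
  have hb2 : ∀ ρ ∈ ZetaZeros.riemannZetaNontrivialZeros, ρ ≠ 1 - conj ρ₀ →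
      ‖c₂ (suzukiZeroParam ρ)‖ ≤
        ε / ‖suzukiZeroParam (1 - conj ρ₀) - suzukiZeroParam ρ‖ ^ (1 + δ) := by
    intro ρ hρ h; rw [hc₂ ρ h]; exact hv₂b ρ hρ h
  have h2 : c₂ (conj (suzukiZeroParam ρ₀)) = 1 := by
    rw [← suzukiZeroParam_one_sub_conj]; exact hc₂₀
  have hlt := hneg c₁ c₂ hc₁₀ h2 hb1 hb2 _ hsum
  rw [Complex.ofReal_re] at hlt
  nlinarith [norm_nonneg (ψ₁ - ψ₂)]

end Summit.RiemannHypothesis.RiemannHypothesis.Theorems.DeBrangesChain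

end
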